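import Literature.AnabelianGeometry.EtaleTheta.TemperedFrobenioidToyTwoPrimes
import Literature.AnabelianGeometry.EtaleTheta.TemperedFrobenioidCor38Sub
import Literature.AnabelianGeometry.EtaleTheta.Discharge.Sec3Remark363
import HarnessLib

/-!
# [EtTh] Cor. 3.8 (ii) sub-DAG, rows C38-L07 / L09 / L10 (FACT-LIST F-2818 / F-2821 / F-2823):
# the induced hull equivalence is NOT a property of the typed record `Cor38Hyp` — universal closure of
# F-2823 `Cor38Hyp.InducesHullEquivalence` decided FALSE (kernel certificate); positive identity instances

S. Mochizuki, *The étale theta function and its Frobenioid-theoretic manifestations*, Publ. RIMS **45**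
(2009) [MochizukiEtTh2009], Cor. 3.8 (ii), PDF p.81 (printed 307), proof PDF p.82 l.1–5: "… it follows from
the explicit description of the base-field-theoretic hull given in Remark 3.6.3 that `Ψ` preserves the
[objects and morphisms of the] subcategories `C₁^bs-fld ⊆ C₁`, `C₂^bs-fld ⊆ C₂`, hence induces an equivalence of
categories `C₁^bs-fld ⥲ C₂^bs-fld`" [cite: MochizukiEtTh2009, Cor 3.8 p.82]; Def. 3.6 (iv) p.78 (the hull
`C^{bs-fld} → C`); Remark 3.6.3 pp.78–79.

abc-iut cell, block F (FACT-LIST fact-proving wave), seat abc-iut-f-133 (tranche 135 float); PROOF-ONLY companion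
(0 definitions) of abc-iut-w5-d124's frozen sub-DAG file `TemperedFrobenioidCor38Sub.lean` (p414329; rows
**C38-L07** `Cor38Hyp.PreservesFactorisation` = F-2818, **C38-L09** `Cor38Hyp.PreservesFrobeniusTrivial` = F-2821,
**C38-L10** `Cor38Hyp.InducesHullEquivalence` = F-2823; class `preparatory`, parametrised by an ARBITRARY record
`h : Cor38Hyp C₁ C₂` over FREE vocabularies).  What the kernel certifies here:

* §1 (any tempered Frobenioids, any vocabularies): if `Ψ` induces a hull equivalence `Ψ^bs` with
  `hull₁ ⋙ Ψ ≅ Ψ^bs ⋙ hull₂` (the typed C38-L10), then `Ψ` carries every morphism in the image of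
  `hull₁ : C₁^{bs-fld} → C₁` into the ESSENTIAL IMAGE of `hull₂` (`essImageHom_of_inducesHullEquivalence`), hence —
  `Φ₂` sharp, by abc-iut-w5-d124's Remark 3.6.3 (⇒) `isBaseFieldTheoretic_of_essImageHom` — to a
  base-field-theoretic morphism of `C₂` (`isBaseFieldTheoretic_map_hull_map_of_inducesHullEquivalence`):
  the converse direction of print's "Since `Ψ` preserves … base-field-theoretic morphisms … hence induces".
* §2 (the certificate): at abc-iut-f-015's two structures on ONE category `TwoPrimes.C 1`, `TwoPrimes.C 0`
  (p430878: `Φ = ℤ_{≥0}² = ⟨e₀, e₁⟩`, `Φ^{bs-fld} = ℤ_{≥0}·e₀` resp. `ℤ_{≥0}·e₁`, `Ψ := 𝟭`, `TwoPrimes.hyp :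
  Cor38Hyp (C 1) (C 0)`), the hull endomorphism `(1, id, e₀, (e₀, e₀))` of `((A, 0) ∈ C 1^{bs-fld})` maps under
  `hull₁ ⋙ Ψ` to a morphism with zero divisor `e₀ ∉ ℤ_{≥0}·e₁`: **`TwoPrimes.not_inducesHullEquivalence :
  ¬ hyp.InducesHullEquivalence`**, so the universal closure (universe level `0`) of F-2823 is FALSE
  (`Cor38Hyp.not_forall_inducesHullEquivalence`), while at the SAME inhabitant F-2818 and F-2821 hold
  (`TwoPrimes.preservesFactorisation_hyp`, `preservesFrobeniusTrivial_hyp`: they are read off the [FrdI]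
  operations `(Base, Div, deg_Fr)`, which the two structures share — `TwoPrimes.category_eq`).
* §3 (positive identity instances, any `C`): at `Ψ = 𝟭 C` all three rows hold
  (`TemperedFrobenioid.preservesFactorisation_refl`, `preservesFrobeniusTrivial_refl`, `inducesHullEquivalence_refl`
  with `Ψ^bs := 𝟭`), in the line of abc-iut-w5-d185's `Sec3PropsSchemaClosures.lean`.

Reading (cell vocabulary, R5): F-2823 is admissible ONLY as its instance forms — abc-iut-w5-d124's derivation
`Cor38Hyp.inducesHullEquivalence_of_rows` (`Discharge/Sec3Cor38Hull.lean`, from Remark 3.6.3 + rows L02a/L06/L08/L09)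
and abc-iut-w6-d040's knit `Cor38Hyp.cor38_ii_of_inputs` (`Discharge/Sec3Cor38iiOfInputs.lean`, p431051); the bare
`∀ h : Cor38Hyp C₁ C₂`-closure cannot be bound as a hypothesis anywhere (it is refuted here).  The ∀-closures of
F-2818 / F-2821 are NOT decided by this file: a countermodel would need an equivalence of model-Frobenioid
categories moving Frobenius degrees / Frobenius-trivial objects, i.e. a typed-interface instance escaping [FrdI]
Thm. 3.4 (ii)/(iii) — not constructed; their instance forms are `preservesFactorisation_of_thm34` (frozen trunk),
abc-iut-f-001's `…_treeCatVocab` family (p430635) and the knit's `preservesFactorisation_of_fact` /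
`preservesFrobeniusTrivial_of_fact` (p431051).  The gap exhibited is a SCHEMA gap of OUR typed interface
(`Cor38Hyp` does not tie `ℝ·Φ₀^cnst` to the category; print determines the constants from the curve); it is not
a claim about the tempered Frobenioids of a curve or about Cor. 3.8 as printed.
HONEST FRAMING: refereed pre-IUT material; nothing here bears on the disputed [IUTchIII] Cor. 3.12; no side taken;
typed ≠ proved — here proved / refuted as stated.
-/

namespace Literature.AnabelianGeometry.EtaleTheta

open CategoryTheory Opposite Literature.AlgebraicGeometry.Frobenioids

universe u₀ v₀ u v w

/-! ### §1 What an induced hull equivalence forces (any vocabularies) -/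

section General

variable {D₀ : Type u₀} [Category.{v₀} D₀] {V : FrdIMonoidStub.{w}} {T : RealifiedDivisorMonoids (D₀ := D₀) V}
  {D : Type u} [Category.{v} D] {VD : FrdICatStub.{u, v, w} D}
  {D₀' : Type u₀} [Category.{v₀} D₀'] {T' : RealifiedDivisorMonoids (D₀ := D₀') V}
  {D' : Type u} [Category.{v} D'] {VD' : FrdICatStub.{u, v, w} D'}
  {C₁ : TemperedFrobenioid T D VD} {C₂ : TemperedFrobenioid T' D' VD'}

namespace Cor38Hyp

variable (h : Cor38Hyp C₁ C₂)

/-- If `Ψ` induces an equivalence of hulls `Ψ^bs` with `hull₁ ⋙ Ψ ≅ Ψ^bs ⋙ hull₂` (row C38-L10), then `Ψ` of a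
morphism in the image of `hull₁ : C₁^{bs-fld} → C₁` is abstractly equivalent ([FrdI] §0) to a morphism in the
image of `hull₂`, i.e. lies in the essential image of `hull₂` ([EtTh] §0). [cite: MochizukiEtTh2009, Cor 3.8 p.82] -/
theorem essImageHom_of_inducesHullEquivalence (hI : h.InducesHullEquivalence) {X Y : C₁.hullCategory}
    (g : X ⟶ Y) : essImageHom C₂.hull (h.Ψ.functor.map (C₁.hull.map g)) := by
  obtain ⟨Ψbs, ⟨η⟩⟩ := hI
  exact ⟨Ψbs.functor.obj X, Ψbs.functor.obj Y, Ψbs.functor.map g,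
    ⟨Arrow.isoMk' ((Ψbs.functor ⋙ C₂.hull).map g) ((C₁.hull ⋙ h.Ψ.functor).map g) (η.symm.app X)
      (η.symm.app Y) (η.inv.naturality g).symm⟩⟩

/-- Hence, when the divisor monoids `Φ₂(A)` are sharp, `Ψ` carries the image of `hull₁` into the
base-field-theoretic morphisms of `C₂` (Remark 3.6.3 (⇒), abc-iut-w5-d124's `isBaseFieldTheoretic_of_essImageHom`)
— the necessary condition behind print's "hence induces an equivalence `C₁^bs-fld ⥲ C₂^bs-fld`" (p.82 l.3–5).
[cite: MochizukiEtTh2009, Cor 3.8 p.82] -/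
theorem isBaseFieldTheoretic_map_hull_map_of_inducesHullEquivalence
    (hS : ∀ A : D', IsSharp (C₂.divisorMonoid.obj (op A))) (hI : h.InducesHullEquivalence)
    {X Y : C₁.hullCategory} (g : X ⟶ Y) : C₂.IsBaseFieldTheoretic (h.Ψ.functor.map (C₁.hull.map g)) :=
  C₂.isBaseFieldTheoretic_of_essImageHom hS _ (h.essImageHom_of_inducesHullEquivalence hI g)

end Cor38Hyp

/-! ### §3 The three rows at the identity equivalence (positive instances, any `C`) -/

namespace TemperedFrobenioid

variable (C : TemperedFrobenioid T D VD)

/-- **C38-L07 / F-2818 at `Ψ = 𝟭 C`**: the identity equivalence of a tempered Frobenioid over a base of FSMFF-type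
with non-dilating `Φ` preserves pre-steps, morphisms of Frobenius type and pull-back morphisms (both directions).
[cite: MochizukiEtTh2009, Cor 3.8 p.81] -/
theorem preservesFactorisation_refl (hD : IsOfFSMFFType D)
    (hnd : ∀ (A : Dᵒᵖ) (f : A ⟶ A), V.IsNonDilating (C.Φ.carrier A) (C.Φ.pull f)) :
    Cor38Hyp.PreservesFactorisation (C₁ := C) (C₂ := C) ⟨.refl, ⟨hD, hD⟩, ⟨hnd, hnd⟩⟩ :=
  ⟨⟨fun _ _ _ hφ => hφ, fun _ _ _ hφ => hφ⟩, ⟨fun _ _ _ hφ => hφ, fun _ _ _ hφ => hφ⟩,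
    fun _ _ _ hφ => hφ, fun _ _ _ hφ => hφ⟩

/-- **C38-L09 / F-2821 at `Ψ = 𝟭 C`**: the identity preserves the Frobenius-trivial objects (both directions).
[cite: MochizukiEtTh2009, Cor 3.8 p.82] -/
theorem preservesFrobeniusTrivial_refl (hD : IsOfFSMFFType D)
    (hnd : ∀ (A : Dᵒᵖ) (f : A ⟶ A), V.IsNonDilating (C.Φ.carrier A) (C.Φ.pull f)) :
    Cor38Hyp.PreservesFrobeniusTrivial (C₁ := C) (C₂ := C) ⟨.refl, ⟨hD, hD⟩, ⟨hnd, hnd⟩⟩ :=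
  ⟨fun _ hA => hA, fun _ hA => hA⟩

/-- **C38-L10 / F-2823 at `Ψ = 𝟭 C`**: the identity induces the identity equivalence of the hull `C^{bs-fld}`,
compatibly with `hull : C^{bs-fld} → C` (`hull ⋙ 𝟭 ≅ 𝟭 ⋙ hull` by the unitors).
[cite: MochizukiEtTh2009, Cor 3.8 p.82] -/
theorem inducesHullEquivalence_refl (hD : IsOfFSMFFType D)
    (hnd : ∀ (A : Dᵒᵖ) (f : A ⟶ A), V.IsNonDilating (C.Φ.carrier A) (C.Φ.pull f)) :
    Cor38Hyp.InducesHullEquivalence (C₁ := C) (C₂ := C) ⟨.refl, ⟨hD, hD⟩, ⟨hnd, hnd⟩⟩ :=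
  ⟨.refl, ⟨C.hull.rightUnitor ≪≫ C.hull.leftUnitor.symm⟩⟩

end TemperedFrobenioid

end General

/-! ### §2 The certificate: two structures on one category (abc-iut-f-015's `TwoPrimes`, p430878) -/

namespace TwoPrimes

/-- The divisor monoids `Φ(A) = ℤ_{≥0}²` of both structures are sharp (`∏ ℤ_{≥0}` has no units), so
isomorphisms of the common category have trivial zero divisor and Remark 3.6.3 (⇒) applies.
[cite: MochizukiEtTh2009, Def 3.6 p.77] -/
theorem isSharp_divisorMonoid (j : Fin 2) (A : Discrete PUnit.{1}) :
    IsSharp ((C j).divisorMonoid.obj (op A)) := by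
  refine ⟨fun a ha => Subtype.ext ?_⟩
  have ha' : IsUnit (M := M) (Subtype.val a) := ha.map ((C j).Φ.carrier (op A)).subtype
  exact PiNat.isSharp.1 _ ha'

/-- **The two structures share the [FrdI] operations `(Base, Div, deg_Fr)`** (L1's `PreFrobenioidData` of the
common category; companion of `TwoPrimes.category_eq`): every row of the Cor. 3.8 sub-DAG that is read off the
operations alone (pre-steps, primary steps, `O^▷(−)`, linear / Frobenius-type / pull-back morphisms,
Frobenius-trivial objects) cannot separate `C 1` from `C 0`. [cite: MochizukiEtTh2009, Def 3.6 p.77] -/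
theorem opsData_eq : (C 0).opsData = (C 1).opsData := rfl

set_option maxHeartbeats 400000 in
/-- **C38-L07 / F-2818 HOLDS at `hyp`**: `Ψ = 𝟭` between the two structures preserves pre-steps, Frobenius-type
and pull-back morphisms — these are read off the shared [FrdI] operations `(Base, Div, deg_Fr)`.
[cite: MochizukiEtTh2009, Cor 3.8 p.81] -/
theorem preservesFactorisation_hyp : hyp.PreservesFactorisation := by
  unfold Cor38Hyp.PreservesFactorisation Cor38Hyp.PreservesPreSteps
  rw [opsData_eq]
  exact ⟨⟨fun _ _ _ hφ => hφ, fun _ _ _ hφ => hφ⟩, ⟨fun _ _ _ hφ => hφ, fun _ _ _ hφ => hφ⟩,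
    fun _ _ _ hφ => hφ, fun _ _ _ hφ => hφ⟩

/-- **C38-L09 / F-2821 HOLDS at `hyp`**: `Ψ = 𝟭` preserves the Frobenius-trivial objects (shared operations).
[cite: MochizukiEtTh2009, Cor 3.8 p.82] -/
theorem preservesFrobeniusTrivial_hyp : hyp.PreservesFrobeniusTrivial := by
  unfold Cor38Hyp.PreservesFrobeniusTrivial
  rw [opsData_eq]
  exact ⟨fun _ hA => hA, fun _ hA => hA⟩

/-- **C38-L10 / F-2823 FAILS at `hyp`**: no equivalence `(C 1)^{bs-fld} ⥲ (C 0)^{bs-fld}` is compatible with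
`Ψ = 𝟭` and the two hull functors.  Witness: the hull endomorphism `(1, id, e₀, (e₀, e₀))` of `(A, 0)` in
`(C 1)^{bs-fld}` (`e₀ ∈ Φ^{bs-fld} = ℤ_{≥0}·e₀` for `C 1`) goes under `hull₁ ⋙ Ψ` to a morphism of zero divisor
`e₀`, which would have to be base-field-theoretic for `C 0` (§1, `Φ` sharp), i.e. `e₀ ∈ ℤ_{≥0}·e₁` — but
`(e₀)_0 = 1 ≠ 0`. [cite: MochizukiEtTh2009, Cor 3.8 p.82] -/
theorem not_inducesHullEquivalence : ¬ hyp.InducesHullEquivalence := by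
  intro hI
  have hker : Algebra.GrothendieckGroup.of (e 0) ∈ (ψ 1).ker := by
    rw [MonoidHom.mem_ker, ψ_of_e, if_neg (by decide)]
    rfl
  -- the object `(A, 0)` of `(C 1)^{bs-fld}` and the datum `e₀ ∈ Φ^{bs-fld}(A)`, `(e₀, e₀) ∈ F^{bs}(A)`
  let X' : (C 1).hullCategory := ⟨⟨⟨⟩⟩, 1⟩
  let d₀ : (C 1).bsFldMonoid.obj (op ⟨⟨⟩⟩) := ⟨e 0, trivial, hker⟩
  let u₀' : (C 1).cnstFnBsFunctor.obj (op ⟨⟨⟩⟩) :=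
    ⟨(Algebra.GrothendieckGroup.of (e 0), Algebra.GrothendieckGroup.of d₀), hker,
      (gpMap_of ((C 1).bsFld.carrier (op ⟨⟨⟩⟩)).subtype d₀).symm⟩
  -- the hull endomorphism `(1, id, e₀, (e₀, e₀))`
  let φ' : X' ⟶ X' := ModelFrobenioid.unitEnd X' d₀ u₀' rfl
  have hbft : (C 0).IsBaseFieldTheoretic (hyp.Ψ.functor.map ((C 1).hull.map φ')) :=
    hyp.isBaseFieldTheoretic_map_hull_map_of_inducesHullEquivalence (isSharp_divisorMonoid 0) hI φ'
  have h2 : ψ 0 (Algebra.GrothendieckGroup.of (e 0)) = 1 := hbft.2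
  rw [ψ_of_e, if_pos rfl] at h2
  exact one_ne_zero (Multiplicative.ofAdd.injective h2)

end TwoPrimes

/-! ### The universal closure of F-2823 -/

/-- **F-2823 as typed is not a fact over ALL `Cor38Hyp` records:** the closure (universe level `0`) of row
C38-L10 `Cor38Hyp.InducesHullEquivalence` is FALSE.  Instance forms: `Cor38Hyp.inducesHullEquivalence_of_rows`
(abc-iut-w5-d124, conditional on Remark 3.6.3 + rows L02a/L06/L08/L09), `Cor38Hyp.cor38_ii_of_inputs`
(abc-iut-w6-d040, p431051), `TemperedFrobenioid.inducesHullEquivalence_refl`. [cite: MochizukiEtTh2009, Cor 3.8 p.82] -/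
theorem Cor38Hyp.not_forall_inducesHullEquivalence :
    ¬ ∀ {D₀ : Type} [Category.{0} D₀] {V : FrdIMonoidStub.{0}} {T : RealifiedDivisorMonoids (D₀ := D₀) V}
        {D : Type} [Category.{0} D] {VD : FrdICatStub.{0, 0, 0} D}
        {D₀' : Type} [Category.{0} D₀'] {T' : RealifiedDivisorMonoids (D₀ := D₀') V}
        {D' : Type} [Category.{0} D'] {VD' : FrdICatStub.{0, 0, 0} D'}
        {C₁ : TemperedFrobenioid T D VD} {C₂ : TemperedFrobenioid T' D' VD'} (h : Cor38Hyp C₁ C₂),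
        h.InducesHullEquivalence :=
  fun h => TwoPrimes.not_inducesHullEquivalence (h TwoPrimes.hyp)

end Literature.AnabelianGeometry.EtaleTheta
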